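import Summits.QuantumFields.YangMills.Theorems.BalabanUVNodesN18End
import Summits.QuantumFields.YangMills.Theorems.BalabanUVNodesN18TwoRunLetters

/-!
# BalabanUVNodes ∕ N18 — «THE END FROM LETTERS»: node N18 = NE5 in the K4 family shape at the torus carriers, the END's
# per-term record binder REPLACED by NODE O's σ-only letters for the two runs' STATIC kernel families, the two TWO-RUN
# closeness letters at rows NE2∕NE3's rate, run A's (L4) + invertibility, (L5), and T42's numerics
# (Track A, DAG node N18 = NE5 `T4OutputRate.NE5 EA EB W κ θ C₅` :211; cluster K4 «SpineRates»)

HONEST FRAMING.  Count-neutral kernel bookkeeping (seat pub-ymgap-dag-n18-a g6; `--supports stmt-QuantumFields-19182`): the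
composition BY NAME of two LANDED files — `N18End.n18_family_of_end8` (the END of row NE5, T53, re-indexed by member and
coupling) and `N18TwoRunLetters` §4 `termWalkData_of_staticLetters_at_window` (the END's record binder from NODE O's
letter interface `NodeOLetters`, static two-run families).  Every letter below is a HYPOTHESIS: nothing of Bałaban's `Γ_k`,
`Δ^{(k)}(Z₀,σ,𝐔,𝐉)`, `C^{(k)}` is constructed (NODE O's instance is 0∕1); the closeness letters (C1)∕(C2) ARE rows NE2∕NE3's
object-level two-run rate in walk-free form and are NOT supplied; NE5 is NOT IN PRINT ([Balaban1987RG1] Thm 1 p. 259: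
uniformity in ε only; mechanism [King1986] p. 665) and NOT PROVED here; NOT a node discharge (no NODE 00 stage pins node U3's
carriers); one finite four-torus programme at fixed ε; nothing continuum ∕ ℝ⁴ ∕ OS ∕ mass-gap ∕ Clay.  0 `def`, 0 `sorry`.

THE POINT.  `n18_family_of_end8` asks, at every WINDOW scale `θ^j < s′`, per member `b`, coupling `g`, domain `Z`, (2.14)-term
`t`, `φ ∈ sp2 Z`, ONE record `TermWalkData (𝒦 b g j Z t φ) (w j)` over the two-run PENCIL (the u-slot of the record's kernels
is the pencil parameter `z`, run A at `z = 0`, run B at `z = 1`; radius `(w j).R = max 2 (s′∕θ^j)·C_R`).  File 8 produces that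
binder from NODE O's letters for BOTH runs + two closeness letters + run A's (L4) + the rate `ϱ_j ≤ C₂θ^j`; for STATIC run
kernels (`𝒦.G2 σ z = K_A σ + z•(K_B σ − K_A σ)`) the letters are σ-only and hold at EVERY pencil radius.  THIS FILE substitutes
one into the other, resolving the quantifier order: T42's reach `s` is fixed FIRST with the slot constants; the END is invoked
with the letters `K̄_Γ := (1+s)(3B_Γ+B′_Γ)`, `K̄_E := (1+s)(3B_E+B′_E)`, `K̄_C := B_C(1−q)⁻¹`, `ε := ε′`, `κ := κ′` and then
EXPORTS `C_R` (with `C_σ, γ₂, a₂₀, w₀`); the window letter is chosen `s′ := s∕(2C₂C_R)` — allowed, the END quantifies the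
window AFTER its exports — so that the END's radius is `N18Knit.window_radius_le_reach`'s verbatim and its window condition is
file 8's; the fibre bound T42 wants on `locΛ` is the record's own field `𝒦.hfib` with the END's `𝒦.m ≤ m`.
The per-term step is file 8 §4 (v1.2) `termWalkData_of_staticLetters_at_window` — file 8 §2 for STATIC families: σ-only
(L1)(L2) for `K_A, K_B, A_A, A_B`, (C1)(C2) per slot at rate `ϱ`, (L4)+(C3) for `A_A`, (L5) at `wj.Rσ`, T42's numerics,
`ϱ ≤ C₂θ^j`, `θ^j < s∕(2C₂C_R)`, the END's package equations ⟹ `TermWalkData 𝒦 wj` (ball radius `:= wj.R`).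
* **`n18_family_of_endLetters`** — THE END FROM LETTERS: the END's quantifier block with `h𝒦` replaced by a RATE
  `0 < ϱ_j ≤ C₂θ^j`, STATIC families `K_A, K_B, A_A, A_B`, the pencil identities, `𝒦.X ≠ ∅`, and the letters (L1)(L2)(C1)(C2) per
  slot, (L4)(C3), (L5); every other binder VERBATIM ⟹ `∀ b ∈ ]0,γ], NE5 (torusCarriers N W) (g ↦ reFunctional N W (E₀ g) g)
  (g ↦ reFunctional N W (E₁ b g) g) W′ ((1−10δ)½Lκ) θ (2A₂C₃ε₁∕s′)` — ONE rate, ONE constant (`= 4C₂C_R·A₂C₃ε₁∕s`).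
So N18's K4 family shape at the NE5 chain's carriers is reduced BY NAME to NODE O's σ-only letters for the two runs' kernels at
the window scales (uniform constants), the two two-run closeness letters at rows NE2∕NE3's rate, run A's (L4)+(C3), and the
END's analytic∕combinatorial binders.  NOT COVERED: the letters and the rate for Bałaban's actual operators (NODE O 0∕1;
rows NE2∕NE3); `θ < 1` is the producer's (`N18End.ne5_of_decayBounds_one_le`); the U3 coherence pins (`N18Coherence`);
`S_N18 RRec` (no `RRec` home yet — `N18AtRecord.s_N18_of_primitiveRate`).

Sources: T. Bałaban, CMP **109** (1987) [Balaban1987RG1] p. 251, (0.24)–(0.25) p. 257, Thm 1 p. 259; CMP **116** (1988)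
[Balaban1988RG2Cluster] (1.5) p. 3, (1.11) p. 5, p. 13, p. 15, (2.13)–(2.26) pp. 14–17, (2.16) p. 16, (2.18) p. 16, (2.31)
p. 18, (2.38) p. 20, (2.41) p. 21; CMP **99** (1985) [Balaban1985BackgroundPropagators] (3.93) p. 410, Thm 3.7 p. 409, Thm 3.10
(3.107)–(3.108) p. 416, (3.130) p. 421; C. King, CMP **102** (1986) [King1986] p. 665.  Nothing here is a claim about the
Yang–Mills mass gap.
-/

noncomputable section

namespace Summit.QuantumFields.YangMills.BalabanUVNodes.N18EndLetters

open Matrix Metric Set Finset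
open Literature.MathematicalPhysics.QuantumFieldTheory.Balaban1983to89
open Literature.MathematicalPhysics.QuantumFieldTheory.Balaban1983to89.T4OutputRate (NE5)
open Literature.MathematicalPhysics.QuantumFieldTheory.Balaban1983to89.TreeLengthTorus (TPt TDom tsys)
open Literature.MathematicalPhysics.QuantumFieldTheory.Balaban1983to89.TreeLengthTorusGeometry (TTouch)
open Literature.MathematicalPhysics.QuantumFieldTheory.Balaban1983to89.TreeLengthTorusTransfer (tclosure)
open Literature.MathematicalPhysics.QuantumFieldTheory.Balaban1983to89.B13Lemma3TorusData (TBond)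
open Literature.MathematicalPhysics.QuantumFieldTheory.Balaban1983to89.B13Lemma3Torus (TwoTorusStep)
open Literature.MathematicalPhysics.QuantumFieldTheory.Balaban1983to89.B13Lemma3TorusTerms (terms weight Z0)
open Literature.MathematicalPhysics.QuantumFieldTheory.Balaban1983to89.B13Term214 (core214 F214 term214)
open Literature.MathematicalPhysics.QuantumFieldTheory.Balaban1983to89.B13Bound143 (invTau)
open Literature.MathematicalPhysics.QuantumFieldTheory.Balaban1983to89.B5TorusCover (UT)
open Literature.MathematicalPhysics.QuantumFieldTheory.Balaban1983to89.B13Resummation (locE)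
open Literature.MathematicalPhysics.QuantumFieldTheory.Balaban1983to89.B13TermWalkData
  (WalkConsts TermKernels TermWalkData)
open Literature.MathematicalPhysics.QuantumFieldTheory.Balaban1983to89.B9Thm34Ext (toB6)
open Literature.MathematicalPhysics.QuantumFieldTheory.Balaban1983to89.B9Thm37GlueTorus (torusGeom tdist1)
open Literature.MathematicalPhysics.QuantumFieldTheory.Balaban1983to89.B11SectG (RowSum)
open Literature.MathematicalPhysics.QuantumFieldTheory.Balaban1983to89.NodeOLetters (distX)
open Summit.QuantumFields.BalabanUV.T4Continuum.Spine.NE5.TwoRunTorusNE5 (torusCarriers reFunctional)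
open Summit.QuantumFields.YangMills.BalabanUVNodes.N18End (n18_family_of_end8)
open Summit.QuantumFields.YangMills.BalabanUVNodes.N18TwoRunLetters (termWalkData_of_staticLetters_at_window)

/-! ## THE END FROM LETTERS -/

open Classical in
/-- **N18 = NE5 IN THE K4 FAMILY SHAPE AT THE TORUS CARRIERS FROM NODE O's σ-ONLY LETTERS FOR THE TWO RUNS, THE TWO-RUN
CLOSENESS LETTERS AT ROWS NE2∕NE3's RATE, RUN A's (L4)+(C3), AND THE END's REMAINING BINDERS («THE END FROM LETTERS»).**
`N18End.n18_family_of_end8` with its record binder `h𝒦` REPLACED: T42's slot constants, numerics, reach `s` and the rate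
constant `C₂` are fixed with `(ν, Nf, m, nΛ, nN)`; the END is invoked with the letters `(1+s)(3B_Γ+B′_Γ)`, `(1+s)(3B_E+B′_E)`,
`B_C(1−q)⁻¹`, `ε′`, `κ′` and EXPORTS `C_R > 2, C_σ, γ₂, a₂₀, w₀`; for every `θ > 0`, `R_σ0`, `M` it exports `w, α, r_P` at the
window letter `s′ = s∕(2C₂C_R)`; then for all carriers, adapter data and records `𝒦 b g j Z t φ`: a RATE `0 < ϱ_j ≤ C₂θ^j`,
STATIC families `K_A, K_B, A_A, A_B` with the pencil identities, `𝒦.X ≠ ∅`, the σ-only letters (L1)(L2) on the polydisc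
`‖σ_i‖ ≤ e^{κ₁+1}`, the closeness letters (C1)(C2) per slot at rate `ϱ_j`, (L4)(C3), (L5) at `(w j).Rσ` — asked only for
`b ∈ ]0,γ]`, `g ∈ W′`, `θ^j < s′`, `t ∈ terms`, `φ ∈ sp2 Z` — and the END's remaining binders VERBATIM ⟹
`∀ b ∈ ]0, γ], NE5 (g ↦ reFunctional N W (E₀ g) g) (g ↦ reFunctional N W (E₁ b g) g) W′ ((1−10δ)½Lκ) θ (2A₂C₃ε₁∕s′)`, ONE
rate and ONE constant (`= 4C₂C_R·A₂C₃ε₁∕s`).  Proof: `n18_family_of_end8` at these letters and window, `h𝒦` supplied by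
`N18TwoRunLetters.termWalkData_of_staticLetters_at_window` per `(b, g, j, Z, t, φ)`.
[cite: Balaban1987RG1, p.251, (0.24)–(0.25) p.257, Thm 1 p.259; Balaban1988RG2Cluster, (1.5) p.3, (1.11) p.5, p.13, p.15, (2.13)–(2.26) pp.14–17, (2.16) p.16, (2.18) p.16, (2.31) p.18, (2.38) p.20, (2.41) p.21; Balaban1985BackgroundPropagators, (3.93) p.410, Thm 3.7 p.409, Thm 3.10 (3.107)–(3.108) p.416, (3.130) p.421; King1986, p.665] -/
theorem n18_family_of_endLetters :
    ∀ (L : ℕ) [NeZero L], 8 ≤ L →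
      ∃ c : B13.Consts, c.L = L ∧ 1 ≤ c.κ₁ ∧ (∀ d : ℝ, 0 ≤ d → 0 < invTau c d ∧ invTau c d ≤ 1 / 2) ∧
      ∀ {ν : ℕ} {Nf : ℕ → Fin ν → ℕ} [∀ j i, NeZero (Nf j i)],
      -- T42's slot constants, numeric side conditions and reach `s`; the rate constant `C₂`; the END's `m, nΛ, nN`
      ∀ {BΓ BΓ' εΓ kapΓ BE BE' εE kapE BC ρC rC κC ρ ρs σ₁ c₁ σ' c' κs κ s ε' kap' C₂ : ℝ} (m : ℕ) {nΛ nN : ℝ},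
      0 ≤ BΓ → 0 ≤ BΓ' → 0 ≤ kapΓ → 0 ≤ BE → 0 ≤ BE' → 0 ≤ kapE → 0 ≤ BC →
      (∀ j, RowSum (toB6 (torusGeom (Nf j) 0 0 0) 0 True) σ₁ c₁) →
      (∀ j, RowSum (toB6 (torusGeom (Nf j) 0 0 0) 0 True) σ' c') →
      0 ≤ σ₁ → 0 ≤ σ' → 0 ≤ c₁ → 0 ≤ c' → 0 ≤ ρ → ρ + σ₁ ≤ ρs → ρs ≤ ρC → ρs + σ₁ ≤ kapE + εE → rC ≤ ρ → κC ≤ rC →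
      kapE ≤ ρ → 0 ≤ κs → κs ≤ kapE → κs + σ' ≤ κC → 0 ≤ κ → κ ≤ κC → κ + σ' ≤ κs →
      (m * c₁) * ((m * c₁) * BC * (s * (3 * BE + BE')) * c') * c' < 1 →
      ε' ≤ εΓ → ε' ≤ εE → kap' ≤ kapΓ → kap' ≤ kapE → kap' ≤ κ → 0 < ε' → 0 < kap' → 0 < s → 0 < C₂ →
      0 ≤ nΛ → 0 ≤ nN →
      ∃ (CR Cσ γ₂ a₂₀ w₀ : ℝ), 2 < CR ∧ 0 < γ₂ ∧ 0 ≤ a₂₀ ∧ 0 < w₀ ∧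
      ∀ {θ : ℝ}, 0 < θ → ∀ (Rσ₀ : ℝ) (M : ℕ) [NeZero M],
      ∃ (w : ℕ → WalkConsts) (α : ℕ → ℝ) (rP : ℝ),
      (∀ j, (w j).Admissible (α j) Rσ₀) ∧ (∀ j, 1 < α j) ∧
      (∀ j, θ ^ j < s / (2 * C₂ * CR) → s / (2 * C₂ * CR) / θ ^ j ≤ α j) ∧
      (∀ j, (w j).KbarΓ = (1 + s) * (3 * BΓ + BΓ') ∧ (w j).KbarE = (1 + s) * (3 * BE + BE') ∧
        (w j).KbarC = BC * (1 - (m * c₁) * ((m * c₁) * BC * (s * (3 * BE + BE')) * c') * c')⁻¹ ∧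
        (w j).kap = kap' ∧ (w j).ε = ε') ∧
      (∀ j, α j = max 2 (s / (2 * C₂ * CR) / θ ^ j)) ∧ (∀ j, (w j).R = max 2 (s / (2 * C₂ * CR) / θ ^ j) * CR) ∧
      (∀ j, (w j).Rσ = max Rσ₀ Cσ) ∧
      ∀ (N : ℕ → ℕ) [∀ j, NeZero (N j)] (W : (j : ℕ) → TwoTorusStep 4 L (N j)) (γ : ℝ) (W' : Set (ℕ → ℝ))
        {Uτ : (j : ℕ) → TDom 4 (L * N j) → Set ℂ}, (∀ j Y, IsOpen (Uτ j Y)) →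
        (∀ j, ∀ Y : TDom 4 (L * N j), closedBall (0 : ℂ) ((invTau c ((tsys 4 (L * N j)).dj Y))⁻¹) ⊆ Uτ j Y) →
        ∀ {r : ℝ}, 0 < r → r ≤ Real.exp c.κ₁ - 1 → (∀ j Y, ∀ ζ ∈ Set.uIcc (0 : ℝ) 1, closedBall (ζ : ℂ) r ⊆ Uτ j Y) →
        ∀ (lZ : (j : ℕ) → TDom 4 (N j) → Finset (TDom 4 (L * N j)) × Finset (TBond 4 M (L * N j)) → List (TPt 4 (N j))),
        (∀ j Z t, (lZ j Z t).Nodup ∧ (lZ j Z t).toFinset = Z.1 \ tclosure L (N j) (Z0 M t)) →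
        ∀ (lD : (j : ℕ) → Finset (TDom 4 (L * N j)) × Finset (TBond 4 M (L * N j)) → List (TDom 4 (L * N j))),
        (∀ j t, (lD j t).Nodup ∧ (lD j t).toFinset = t.1) →
        -- the records, indexed by the member `b` and the coupling sequence `g`
        ∀ (𝒦 : (b : ℝ) → (g : ℕ → ℝ) → (j : ℕ) → (Z : TDom 4 (N j)) →
            Finset (TDom 4 (L * N j)) × Finset (TBond 4 M (L * N j)) → (W j).Φ →
            TermKernels ({ c with κ₁ := c.κ₁ + 1 } : B13.Consts) 4 (N j) ν (Nf j) ℂ)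
          [∀ b g j Z t φ, Fintype (𝒦 b g j Z t φ).C₀] [∀ b g j Z t φ, DecidableEq (𝒦 b g j Z t φ).C₀],
        -- rows NE2∕NE3's RATE
        ∀ (ϱ : ℕ → ℝ), (∀ j, 0 < ϱ j) → (∀ j, ϱ j ≤ C₂ * θ ^ j) →
        -- NODE O's STATIC kernel families of the two runs, per record: Γ-kernels `K_A, K_B`, precisions `A_A, A_B`
        ∀ (KA KB : (b : ℝ) → (g : ℕ → ℝ) → (j : ℕ) → (Z : TDom 4 (N j)) →
            (t : Finset (TDom 4 (L * N j)) × Finset (TBond 4 M (L * N j))) → (φ : (W j).Φ) →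
            (TPt 4 (N j) → ℂ) → Matrix (𝒦 b g j Z t φ).Λ ((𝒦 b g j Z t φ).Λ ⊕ (𝒦 b g j Z t φ).C₀) ℂ)
          (AA AB : (b : ℝ) → (g : ℕ → ℝ) → (j : ℕ) → (Z : TDom 4 (N j)) →
            (t : Finset (TDom 4 (L * N j)) × Finset (TBond 4 M (L * N j))) → (φ : (W j).Φ) →
            (TPt 4 (N j) → ℂ) → Matrix (𝒦 b g j Z t φ).Λ (𝒦 b g j Z t φ).Λ ℂ),
        -- the record's Γ-kernel and precision ARE the pencils through run A (`z = 0`) and run B (`z = 1`); `𝒦.X ≠ ∅`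
        (∀ b : ℝ, 0 < b → b ≤ γ → ∀ g ∈ W', ∀ j, θ ^ j < s / (2 * C₂ * CR) → ∀ Z, ∀ t ∈ terms L M Z, ∀ φ,
          φ ∈ (W j).sp2 Z → ∀ σ z,
            (𝒦 b g j Z t φ).G2 σ z = KA b g j Z t φ σ + z • (KB b g j Z t φ σ - KA b g j Z t φ σ)) →
        (∀ b : ℝ, 0 < b → b ≤ γ → ∀ g ∈ W', ∀ j, θ ^ j < s / (2 * C₂ * CR) → ∀ Z, ∀ t ∈ terms L M Z, ∀ φ,
          φ ∈ (W j).sp2 Z → ∀ σ z,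
            (𝒦 b g j Z t φ).A2 σ z = AA b g j Z t φ σ + z • (AB b g j Z t φ σ - AA b g j Z t φ σ)) →
        (∀ b : ℝ, 0 < b → b ≤ γ → ∀ g ∈ W', ∀ j, θ ^ j < s / (2 * C₂ * CR) → ∀ Z, ∀ t ∈ terms L M Z, ∀ φ,
          φ ∈ (W j).sp2 Z → (𝒦 b g j Z t φ).X.Nonempty) →
        -- (L1)(L2) for run A's and run B's Γ-kernels (constants `B_Γ, B′_Γ`, rate `κ_Γ + ε_Γ`)
        (∀ b : ℝ, 0 < b → b ≤ γ → ∀ g ∈ W', ∀ j, θ ^ j < s / (2 * C₂ * CR) → ∀ Z, ∀ t ∈ terms L M Z, ∀ φ,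
          φ ∈ (W j).sp2 Z → ∀ σ : TPt 4 (N j) → ℂ, (∀ i, ‖σ i‖ ≤ Real.exp (c.κ₁ + 1)) → ∀ i k,
            ‖KA b g j Z t φ σ i k‖ ≤ BΓ * Real.exp (-((kapΓ + εΓ) *
              tdist1 (Nf j) ((𝒦 b g j Z t φ).locΛ i) ((𝒦 b g j Z t φ).locN k)))) →
        (∀ b : ℝ, 0 < b → b ≤ γ → ∀ g ∈ W', ∀ j, θ ^ j < s / (2 * C₂ * CR) → ∀ Z, ∀ t ∈ terms L M Z, ∀ φ,
          φ ∈ (W j).sp2 Z → ∀ σ : TPt 4 (N j) → ℂ, (∀ i, ‖σ i‖ ≤ Real.exp (c.κ₁ + 1)) → ∀ i k,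
            ‖KA b g j Z t φ σ i k - KA b g j Z t φ 0 i k‖ ≤ BΓ' * Real.exp (-((kapΓ + εΓ) *
              distX (𝒦 b g j Z t φ).X ((𝒦 b g j Z t φ).locΛ i) ((𝒦 b g j Z t φ).locN k)))) →
        (∀ b : ℝ, 0 < b → b ≤ γ → ∀ g ∈ W', ∀ j, θ ^ j < s / (2 * C₂ * CR) → ∀ Z, ∀ t ∈ terms L M Z, ∀ φ,
          φ ∈ (W j).sp2 Z → ∀ σ : TPt 4 (N j) → ℂ, (∀ i, ‖σ i‖ ≤ Real.exp (c.κ₁ + 1)) → ∀ i k,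
            ‖KB b g j Z t φ σ i k‖ ≤ BΓ * Real.exp (-((kapΓ + εΓ) *
              tdist1 (Nf j) ((𝒦 b g j Z t φ).locΛ i) ((𝒦 b g j Z t φ).locN k)))) →
        (∀ b : ℝ, 0 < b → b ≤ γ → ∀ g ∈ W', ∀ j, θ ^ j < s / (2 * C₂ * CR) → ∀ Z, ∀ t ∈ terms L M Z, ∀ φ,
          φ ∈ (W j).sp2 Z → ∀ σ : TPt 4 (N j) → ℂ, (∀ i, ‖σ i‖ ≤ Real.exp (c.κ₁ + 1)) → ∀ i k,
            ‖KB b g j Z t φ σ i k - KB b g j Z t φ 0 i k‖ ≤ BΓ' * Real.exp (-((kapΓ + εΓ) *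
              distX (𝒦 b g j Z t φ).X ((𝒦 b g j Z t φ).locΛ i) ((𝒦 b g j Z t φ).locN k)))) →
        -- the TWO-RUN closeness letters (C1)(C2) for the Γ-kernels at the rate `ϱ_j`
        (∀ b : ℝ, 0 < b → b ≤ γ → ∀ g ∈ W', ∀ j, θ ^ j < s / (2 * C₂ * CR) → ∀ Z, ∀ t ∈ terms L M Z, ∀ φ,
          φ ∈ (W j).sp2 Z → ∀ σ : TPt 4 (N j) → ℂ, (∀ i, ‖σ i‖ ≤ Real.exp (c.κ₁ + 1)) → ∀ i k,
            ‖KB b g j Z t φ σ i k - KA b g j Z t φ σ i k‖ ≤ ϱ j * (BΓ * Real.exp (-((kapΓ + εΓ) *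
              tdist1 (Nf j) ((𝒦 b g j Z t φ).locΛ i) ((𝒦 b g j Z t φ).locN k))))) →
        (∀ b : ℝ, 0 < b → b ≤ γ → ∀ g ∈ W', ∀ j, θ ^ j < s / (2 * C₂ * CR) → ∀ Z, ∀ t ∈ terms L M Z, ∀ φ,
          φ ∈ (W j).sp2 Z → ∀ σ : TPt 4 (N j) → ℂ, (∀ i, ‖σ i‖ ≤ Real.exp (c.κ₁ + 1)) → ∀ i k,
            ‖(KB b g j Z t φ σ i k - KB b g j Z t φ 0 i k) - (KA b g j Z t φ σ i k - KA b g j Z t φ 0 i k)‖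
              ≤ ϱ j * (BΓ' * Real.exp (-((kapΓ + εΓ) *
                distX (𝒦 b g j Z t φ).X ((𝒦 b g j Z t φ).locΛ i) ((𝒦 b g j Z t φ).locN k))))) →
        -- (L1)(L2) for run A's and run B's precisions (constants `B_E, B′_E`, rate `κ_E + ε_E`)
        (∀ b : ℝ, 0 < b → b ≤ γ → ∀ g ∈ W', ∀ j, θ ^ j < s / (2 * C₂ * CR) → ∀ Z, ∀ t ∈ terms L M Z, ∀ φ,
          φ ∈ (W j).sp2 Z → ∀ σ : TPt 4 (N j) → ℂ, (∀ i, ‖σ i‖ ≤ Real.exp (c.κ₁ + 1)) → ∀ i k,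
            ‖AA b g j Z t φ σ i k‖ ≤ BE * Real.exp (-((kapE + εE) *
              tdist1 (Nf j) ((𝒦 b g j Z t φ).locΛ i) ((𝒦 b g j Z t φ).locΛ k)))) →
        (∀ b : ℝ, 0 < b → b ≤ γ → ∀ g ∈ W', ∀ j, θ ^ j < s / (2 * C₂ * CR) → ∀ Z, ∀ t ∈ terms L M Z, ∀ φ,
          φ ∈ (W j).sp2 Z → ∀ σ : TPt 4 (N j) → ℂ, (∀ i, ‖σ i‖ ≤ Real.exp (c.κ₁ + 1)) → ∀ i k,
            ‖AA b g j Z t φ σ i k - AA b g j Z t φ 0 i k‖ ≤ BE' * Real.exp (-((kapE + εE) *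
              distX (𝒦 b g j Z t φ).X ((𝒦 b g j Z t φ).locΛ i) ((𝒦 b g j Z t φ).locΛ k)))) →
        (∀ b : ℝ, 0 < b → b ≤ γ → ∀ g ∈ W', ∀ j, θ ^ j < s / (2 * C₂ * CR) → ∀ Z, ∀ t ∈ terms L M Z, ∀ φ,
          φ ∈ (W j).sp2 Z → ∀ σ : TPt 4 (N j) → ℂ, (∀ i, ‖σ i‖ ≤ Real.exp (c.κ₁ + 1)) → ∀ i k,
            ‖AB b g j Z t φ σ i k‖ ≤ BE * Real.exp (-((kapE + εE) *
              tdist1 (Nf j) ((𝒦 b g j Z t φ).locΛ i) ((𝒦 b g j Z t φ).locΛ k)))) →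
        (∀ b : ℝ, 0 < b → b ≤ γ → ∀ g ∈ W', ∀ j, θ ^ j < s / (2 * C₂ * CR) → ∀ Z, ∀ t ∈ terms L M Z, ∀ φ,
          φ ∈ (W j).sp2 Z → ∀ σ : TPt 4 (N j) → ℂ, (∀ i, ‖σ i‖ ≤ Real.exp (c.κ₁ + 1)) → ∀ i k,
            ‖AB b g j Z t φ σ i k - AB b g j Z t φ 0 i k‖ ≤ BE' * Real.exp (-((kapE + εE) *
              distX (𝒦 b g j Z t φ).X ((𝒦 b g j Z t φ).locΛ i) ((𝒦 b g j Z t φ).locΛ k)))) →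
        -- the TWO-RUN closeness letters (C1)(C2) for the precisions at the rate `ϱ_j`
        (∀ b : ℝ, 0 < b → b ≤ γ → ∀ g ∈ W', ∀ j, θ ^ j < s / (2 * C₂ * CR) → ∀ Z, ∀ t ∈ terms L M Z, ∀ φ,
          φ ∈ (W j).sp2 Z → ∀ σ : TPt 4 (N j) → ℂ, (∀ i, ‖σ i‖ ≤ Real.exp (c.κ₁ + 1)) → ∀ i k,
            ‖AB b g j Z t φ σ i k - AA b g j Z t φ σ i k‖ ≤ ϱ j * (BE * Real.exp (-((kapE + εE) *
              tdist1 (Nf j) ((𝒦 b g j Z t φ).locΛ i) ((𝒦 b g j Z t φ).locΛ k))))) →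
        (∀ b : ℝ, 0 < b → b ≤ γ → ∀ g ∈ W', ∀ j, θ ^ j < s / (2 * C₂ * CR) → ∀ Z, ∀ t ∈ terms L M Z, ∀ φ,
          φ ∈ (W j).sp2 Z → ∀ σ : TPt 4 (N j) → ℂ, (∀ i, ‖σ i‖ ≤ Real.exp (c.κ₁ + 1)) → ∀ i k,
            ‖(AB b g j Z t φ σ i k - AB b g j Z t φ 0 i k) - (AA b g j Z t φ σ i k - AA b g j Z t φ 0 i k)‖
              ≤ ϱ j * (BE' * Real.exp (-((kapE + εE) *
                distX (𝒦 b g j Z t φ).X ((𝒦 b g j Z t φ).locΛ i) ((𝒦 b g j Z t φ).locΛ k))))) →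
        -- run A's inverse precision: NODE O's letter (L4) and invertibility (C3)
        (∀ b : ℝ, 0 < b → b ≤ γ → ∀ g ∈ W', ∀ j, θ ^ j < s / (2 * C₂ * CR) → ∀ Z, ∀ t ∈ terms L M Z, ∀ φ,
          φ ∈ (W j).sp2 Z → ∀ σ : TPt 4 (N j) → ℂ, (∀ i, ‖σ i‖ ≤ Real.exp (c.κ₁ + 1)) → ∀ i k,
            ‖(AA b g j Z t φ σ)⁻¹ i k‖ ≤ BC * Real.exp (-(ρC *
              tdist1 (Nf j) ((𝒦 b g j Z t φ).locΛ i) ((𝒦 b g j Z t φ).locΛ k)))) →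
        (∀ b : ℝ, 0 < b → b ≤ γ → ∀ g ∈ W', ∀ j, θ ^ j < s / (2 * C₂ * CR) → ∀ Z, ∀ t ∈ terms L M Z, ∀ φ,
          φ ∈ (W j).sp2 Z → ∀ σ : TPt 4 (N j) → ℂ, (∀ i, ‖σ i‖ ≤ Real.exp (c.κ₁ + 1)) →
            AA b g j Z t φ σ * (AA b g j Z t φ σ)⁻¹ = 1) →
        -- the geometric clause (L5) at the package's σ-distance `(w j).Rσ = max R_σ0 C_σ`
        (∀ b : ℝ, 0 < b → b ≤ γ → ∀ g ∈ W', ∀ j, θ ^ j < s / (2 * C₂ * CR) → ∀ Z, ∀ t ∈ terms L M Z, ∀ φ,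
          φ ∈ (W j).sp2 Z → ∀ i, ∀ x ∈ (𝒦 b g j Z t φ).X, (w j).Rσ ≤ tdist1 (Nf j) ((𝒦 b g j Z t φ).locΛ i) x) →
        -- the END's remaining binders, VERBATIM (`N18End.n18_family_of_end8` :130–:205 at the window `s′`)
        ∀ (Γ : (b : ℝ) → (g : ℕ → ℝ) → (j : ℕ) → (Z : TDom 4 (N j)) →
            (t : Finset (TDom 4 (L * N j)) × Finset (TBond 4 M (L * N j))) → (φ : (W j).Φ) → ℂ → (TPt 4 (N j) → ℂ) →
            ((𝒦 b g j Z t φ).Λ ⊕ (𝒦 b g j Z t φ).C₀ → ℝ) → ((𝒦 b g j Z t φ).Λ → ℂ)),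
        (∀ b : ℝ, 0 < b → b ≤ γ → ∀ g ∈ W', ∀ j, θ ^ j < s / (2 * C₂ * CR) → ∀ Z, ∀ t ∈ terms L M Z, ∀ φ,
          φ ∈ (W j).sp2 Z →
          ∀ z ∈ ball (0 : ℂ) (α j), ∀ σ : TPt 4 (N j) → ℂ, (∀ i, σ i ∈ ball (0 : ℂ) (Real.exp (c.κ₁ + 1))) →
            ∀ X : (𝒦 b g j Z t φ).Λ ⊕ (𝒦 b g j Z t φ).C₀ → ℝ,
              Γ b g j Z t φ z σ X = (𝒦 b g j Z t φ).G2 σ z *ᵥ fun i => (X i : ℂ)) →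
        ∀ (χY₀ χcP : (b : ℝ) → (g : ℕ → ℝ) → (j : ℕ) → (Z : TDom 4 (N j)) →
            (t : Finset (TDom 4 (L * N j)) × Finset (TBond 4 M (L * N j))) → (φ : (W j).Φ) →
            ((𝒦 b g j Z t φ).Λ → ℝ) → ℝ),
        (∀ b : ℝ, 0 < b → b ≤ γ → ∀ g ∈ W', ∀ j Z t φ Bf, 0 ≤ χY₀ b g j Z t φ Bf) →
        (∀ b : ℝ, 0 < b → b ≤ γ → ∀ g ∈ W', ∀ j Z t φ Bf, 0 ≤ χcP b g j Z t φ Bf) →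
        ∀ (Dfam : (b : ℝ) → (g : ℕ → ℝ) → (j : ℕ) → TDom 4 (N j) →
            Finset (TDom 4 (L * N j)) × Finset (TBond 4 M (L * N j)) → Finset (TDom 4 (L * N j)))
          (Vk : (b : ℝ) → (g : ℕ → ℝ) → (j : ℕ) → (Z : TDom 4 (N j)) →
            (t : Finset (TDom 4 (L * N j)) × Finset (TBond 4 M (L * N j))) → (φ : (W j).Φ) → ℂ → TDom 4 (L * N j) →
            ((𝒦 b g j Z t φ).Λ → ℝ) → ℂ),
        (∀ b : ℝ, 0 < b → b ≤ γ → ∀ g ∈ W', ∀ j, θ ^ j < s / (2 * C₂ * CR) → ∀ Z, ∀ t ∈ terms L M Z, ∀ φ,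
          φ ∈ (W j).sp2 Z → ∀ z ∈ ball (0 : ℂ) (α j), ∀ i i',
            DifferentiableOn ℂ (fun σ => (𝒦 b g j Z t φ).A2 σ z i i')
              {σ | ∀ i, σ i ∈ ball (0 : ℂ) (Real.exp (c.κ₁ + 1))}) →
        (∀ b : ℝ, 0 < b → b ≤ γ → ∀ g ∈ W', ∀ j, θ ^ j < s / (2 * C₂ * CR) → ∀ Z, ∀ t ∈ terms L M Z, ∀ φ,
          φ ∈ (W j).sp2 Z → ∀ z ∈ ball (0 : ℂ) (α j), ∀ i i',
            DifferentiableOn ℂ (fun σ => (𝒦 b g j Z t φ).G2 σ z i i')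
              {σ | ∀ i, σ i ∈ ball (0 : ℂ) (Real.exp (c.κ₁ + 1))}) →
        (∀ b : ℝ, 0 < b → b ≤ γ → ∀ g ∈ W', ∀ j, θ ^ j < s / (2 * C₂ * CR) → ∀ Z, ∀ t ∈ terms L M Z, ∀ φ,
          φ ∈ (W j).sp2 Z → ∀ Y Bf, DifferentiableOn ℂ (fun z => Vk b g j Z t φ z Y Bf) (ball (0 : ℂ) (α j))) →
        (∀ b : ℝ, 0 < b → b ≤ γ → ∀ g ∈ W', ∀ j Z t φ, Measurable (χY₀ b g j Z t φ)) →
        (∀ b : ℝ, 0 < b → b ≤ γ → ∀ g ∈ W', ∀ j Z t φ, Measurable (χcP b g j Z t φ)) →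
        (∀ b : ℝ, 0 < b → b ≤ γ → ∀ g ∈ W', ∀ j, θ ^ j < s / (2 * C₂ * CR) → ∀ Z, ∀ t ∈ terms L M Z, ∀ φ,
          φ ∈ (W j).sp2 Z → ∀ z ∈ ball (0 : ℂ) (α j), ∀ Y, Measurable (Vk b g j Z t φ z Y)) →
        (∀ b : ℝ, 0 < b → b ≤ γ → ∀ g ∈ W', ∀ j, θ ^ j < s / (2 * C₂ * CR) → ∀ Z, ∀ t ∈ terms L M Z, ∀ φ,
          φ ∈ (W j).sp2 Z → ∀ z : ℂ, ‖z‖ ≤ α j → ∀ σ : TPt 4 (N j) → ℂ, (∀ i, ‖σ i‖ ≤ Real.exp (c.κ₁ + 1)) →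
            ((𝒦 b g j Z t φ).A2 σ z).IsSymm) →
        ∀ {w₂₀ : ℝ} (qP : (b : ℝ) → (g : ℕ → ℝ) → (j : ℕ) → (Z : TDom 4 (N j)) →
            (t : Finset (TDom 4 (L * N j)) × Finset (TBond 4 M (L * N j))) → (φ : (W j).Φ) →
            ((𝒦 b g j Z t φ).Λ → ℝ) → ℝ),
        (∀ b : ℝ, 0 < b → b ≤ γ → ∀ g ∈ W', ∀ j Z t φ Bf, χY₀ b g j Z t φ Bf * χcP b g j Z t φ Bf ≤
          Real.exp (-(γ₂ / 2 * rP ^ 2 * (t.2.card : ℕ)) + γ₂ / 2 * qP b g j Z t φ Bf)) →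
        (∀ b : ℝ, 0 < b → b ≤ γ → ∀ g ∈ W', ∀ j Z t φ Bf, qP b g j Z t φ Bf ≤ Bf ⬝ᵥ Bf) →
        (∀ b : ℝ, 0 < b → b ≤ γ → ∀ g ∈ W', ∀ j, θ ^ j < s / (2 * C₂ * CR) → ∀ Z, ∀ t ∈ terms L M Z, ∀ φ,
          φ ∈ (W j).sp2 Z → ∀ z ∈ ball (0 : ℂ) (α j), ∀ τ : TDom 4 (L * N j) → ℂ, (∀ Y, τ Y ∈ Uτ j Y) →
            ∀ Bf, ∑ Y ∈ Dfam b g j Z t, ‖τ Y‖ * ‖Vk b g j Z t φ z Y Bf‖ ≤ a₂₀ / 2 * (Bf ⬝ᵥ Bf) + w₂₀) →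
        (∀ j, ∀ Z : TDom 4 (N j), w₂₀ ≤ w₀ * ((Z.1).card : ℝ)) →
        (∀ b : ℝ, 0 < b → b ≤ γ → ∀ g ∈ W', ∀ j, θ ^ j < s / (2 * C₂ * CR) → ∀ Z t φ, (𝒦 b g j Z t φ).m ≤ m) →
        (∀ b : ℝ, 0 < b → b ≤ γ → ∀ g ∈ W', ∀ j, θ ^ j < s / (2 * C₂ * CR) → ∀ Z t φ, ∀ x : UT (Nf j),
          (Finset.univ.filter fun i => (𝒦 b g j Z t φ).locN i = x).card ≤ m) →
        (∀ b : ℝ, 0 < b → b ≤ γ → ∀ g ∈ W', ∀ j, θ ^ j < s / (2 * C₂ * CR) → ∀ Z t φ,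
          (Fintype.card (𝒦 b g j Z t φ).Λ : ℝ) ≤ nΛ * ((Z.1).card : ℝ)) →
        (∀ b : ℝ, 0 < b → b ≤ γ → ∀ g ∈ W', ∀ j, θ ^ j < s / (2 * C₂ * CR) → ∀ Z t φ,
          (Fintype.card ((𝒦 b g j Z t φ).Λ ⊕ (𝒦 b g j Z t φ).C₀) : ℝ) ≤ nN * ((Z.1).card : ℝ)) →
        ∀ {H : (b : ℝ) → (g : ℕ → ℝ) → (j : ℕ) → ℂ → TDom 4 (N j) → (W j).Φ → ℂ},
        (∀ b : ℝ, 0 < b → b ≤ γ → ∀ g ∈ W', ∀ j, θ ^ j < s / (2 * C₂ * CR) → ∀ z ∈ ball (0 : ℂ) (α j),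
          ∀ (Z : TDom 4 (N j)) (φ : (W j).Φ), φ ∈ (W j).sp2 Z →
          H b g j z Z φ = ∑ t ∈ terms L M Z,
            term214 r (lZ j Z t) (lD j t) (core214 (fun σ => (𝒦 b g j Z t φ).A2 σ z) (Γ b g j Z t φ z)
              (F214 t.2.card (χY₀ b g j Z t φ) (χcP b g j Z t φ) (Dfam b g j Z t) (Vk b g j Z t φ z))) 0 0) →
        (∀ j, ∀ X Z : TDom 4 (N j), ∀ φ, Z.1 ⊆ X.1 → φ ∈ (W j).sp2 X → φ ∈ (W j).sp2 Z) →
        ∀ {E : (b : ℝ) → (g : ℕ → ℝ) → (j : ℕ) → ℂ → TDom 4 (N j) → (W j).Φ → ℂ},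
        (∀ b : ℝ, 0 < b → b ≤ γ → ∀ g ∈ W', ∀ j, θ ^ j < s / (2 * C₂ * CR) → ∀ z ∈ ball (0 : ℂ) (α j),
          ∀ (X : TDom 4 (N j)) (φ : (W j).Φ), φ ∈ (W j).sp2 X →
          E b g j z X φ =
            locE (TTouch (d := 4) (N := N j)) (fun Z : TDom 4 (N j) => Z.1) (fun Z => H b g j z Z φ) X.1) →
        (∀ b : ℝ, 0 < b → b ≤ γ → ∀ g ∈ W', ∀ j (X : TDom 4 (N j)) (φ : (W j).Φ), φ ∈ (W j).sp2 X →
          ‖E b g j 0 X φ‖ ≤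
            c.A₂ * c.C3act * c.ε₁ * Real.exp (-((1 - 10 * c.δ) * ((c.L : ℝ) / 2) * c.κ * (tsys 4 (N j)).dj X))) →
        (∀ b : ℝ, 0 < b → b ≤ γ → ∀ g ∈ W', ∀ j (X : TDom 4 (N j)) (φ : (W j).Φ), φ ∈ (W j).sp2 X →
          ‖E b g j 1 X φ‖ ≤
            c.A₂ * c.C3act * c.ε₁ * Real.exp (-((1 - 10 * c.δ) * ((c.L : ℝ) / 2) * c.κ * (tsys 4 (N j)).dj X))) →
        -- the members ARE the coupling-indexed outputs of run A and of run B's family, on the spaces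
        ∀ (E₀ : (g : ℕ → ℝ) → (j : ℕ) → TDom 4 (N j) → (W j).Φ → ℂ)
          (E₁ : (b : ℝ) → (g : ℕ → ℝ) → (j : ℕ) → TDom 4 (N j) → (W j).Φ → ℂ),
        (∀ b : ℝ, 0 < b → b ≤ γ → ∀ g ∈ W', ∀ j (X : TDom 4 (N j)) (φ : (W j).Φ), φ ∈ (W j).sp2 X →
          E b g j 0 X φ = E₀ g j X φ) →
        (∀ b : ℝ, 0 < b → b ≤ γ → ∀ g ∈ W', ∀ j (X : TDom 4 (N j)) (φ : (W j).Φ), φ ∈ (W j).sp2 X →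
          E b g j 1 X φ = E₁ b g j X φ) →
        ∀ b : ℝ, 0 < b → b ≤ γ →
          NE5 (C := torusCarriers N W) (fun g => reFunctional N W (E₀ g) g) (fun g => reFunctional N W (E₁ b g) g)
            W' ((1 - 10 * c.δ) * ((c.L : ℝ) / 2) * c.κ) θ (2 * (c.A₂ * c.C3act * c.ε₁) / (s / (2 * C₂ * CR))) := by
  intro L _ hLL
  obtain ⟨c, hLc, hκ₁, hτ, hEND⟩ := n18_family_of_end8 L hLL
  refine ⟨c, hLc, hκ₁, hτ, ?_⟩
  intro ν Nf _ BΓ BΓ' εΓ kapΓ BE BE' εE kapE BC ρC rC κC ρ ρs σ₁ c₁ σ' c' κs κ s ε' kap' C₂ m nΛ nN hBΓ hBΓ' hkapΓ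
    hBE hBE' hkapE hBC hrow hrow' hσ₁ hσ' hc₁ hc' hρ hρs hρsC hρsE hrC hκrC hrE hκs hκsE hκsC hκ hκC hκκs hq hε'Γ hε'E
    hkap'Γ hkap'E hkap'κ hε' hkap' hs hC₂ hnΛ hnN
  -- the END's letters: `K̄_Γ := (1+s)(3B_Γ+B′_Γ)`, `K̄_E := (1+s)(3B_E+B′_E)`, `K̄_C := B_C(1−q)⁻¹`, `ε := ε′`, `κ := κ′`
  have hKΓ : 0 ≤ (1 + s) * (3 * BΓ + BΓ') := by positivity
  have hKE : 0 ≤ (1 + s) * (3 * BE + BE') := by positivity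
  have hKC : 0 ≤ BC * (1 - (m * c₁) * ((m * c₁) * BC * (s * (3 * BE + BE')) * c') * c')⁻¹ :=
    mul_nonneg hBC (inv_nonneg.mpr (by linarith))
  obtain ⟨CR, Cσ, γ₂, a₂₀, w₀, hCR, hγ₂, ha₂₀, hw₀, hEND⟩ :=
    hEND (ν := ν) (Nf := Nf) hKΓ hKE hKC hε' hkap' m hnΛ hnN
  refine ⟨CR, Cσ, γ₂, a₂₀, w₀, hCR, hγ₂, ha₂₀, hw₀, ?_⟩
  intro θ hθ Rσ₀ M _
  have hCR0 : 0 < CR := by linarith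
  -- the END at the window letter `s′ := s ∕ (2 C₂ C_R)`, chosen AFTER the export of `C_R`
  have hs' : 0 < s / (2 * C₂ * CR) := by positivity
  obtain ⟨w, α, rP, hw, hα1, hαs, hlett, hαeq, hReq, hRσeq, hEND⟩ := hEND hθ hs' Rσ₀ M
  refine ⟨w, α, rP, hw, hα1, hαs, hlett, hαeq, hReq, hRσeq, ?_⟩
  intro N _ W γ W' Uτ hUτ hUtau r hr hr' hsubτ lZ hlZ lD hlD 𝒦 _ _ ϱ hϱ hrate KA KB AA AB hG2 hA2 hXne hΓA hΓA' hΓB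
    hΓB' hcloseΓ hlocΓ hEA hEA' hEB hEB' hcloseE hlocE hC4 hAC hfar Γ hlin χY₀ χcP hχ0 hχc0 Dfam Vk hAhol hGhol hVholb
    hχm hχcm hVm hAs w₂₀ qP h222 hqP h220U hw₂₀ hm
  -- the END's per-term record binder FROM THE LETTERS (file 8 §4), per member, coupling, window scale, domain, term, `φ`
  have h𝒦 : ∀ b : ℝ, 0 < b → b ≤ γ → ∀ g ∈ W', ∀ j, θ ^ j < s / (2 * C₂ * CR) → ∀ Z, ∀ t ∈ terms L M Z, ∀ φ,
      φ ∈ (W j).sp2 Z → TermWalkData (𝒦 b g j Z t φ) (w j) := by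
    intro b hb hbγ g hg j hj Z t ht φ hφ
    exact termWalkData_of_staticLetters_at_window (𝒦 b g j Z t φ) (hXne b hb hbγ g hg j hj Z t ht φ hφ)
      (hG2 b hb hbγ g hg j hj Z t ht φ hφ) (hA2 b hb hbγ g hg j hj Z t ht φ hφ) hBΓ hBΓ' hkapΓ
      (hΓA b hb hbγ g hg j hj Z t ht φ hφ) (hΓA' b hb hbγ g hg j hj Z t ht φ hφ)
      (hΓB b hb hbγ g hg j hj Z t ht φ hφ) (hΓB' b hb hbγ g hg j hj Z t ht φ hφ)
      (hcloseΓ b hb hbγ g hg j hj Z t ht φ hφ) (hlocΓ b hb hbγ g hg j hj Z t ht φ hφ) hBE hBE' hkapE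
      (hEA b hb hbγ g hg j hj Z t ht φ hφ) (hEA' b hb hbγ g hg j hj Z t ht φ hφ)
      (hEB b hb hbγ g hg j hj Z t ht φ hφ) (hEB' b hb hbγ g hg j hj Z t ht φ hφ)
      (hcloseE b hb hbγ g hg j hj Z t ht φ hφ) (hlocE b hb hbγ g hg j hj Z t ht φ hφ) hBC
      (hC4 b hb hbγ g hg j hj Z t ht φ hφ) (hAC b hb hbγ g hg j hj Z t ht φ hφ) (hm b hb hbγ g hg j hj Z t φ)
      (hrow j) (hrow' j) hσ₁ hσ' hc₁ hc' hρ hρs hρsC hρsE hrC hκrC hrE hκs hκsE hκsC hκ hκC hκκs hq hε'Γ hε'E hkap'Γ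
      hkap'E hkap'κ (w j) hθ hs hC₂ hCR0 (hϱ j) (hrate j) hj (hReq j) (hlett j).2.2.2.2 (hlett j).2.2.2.1 (hlett j).1
      (hlett j).2.1 (hlett j).2.2.1 (hfar b hb hbγ g hg j hj Z t ht φ hφ)
  exact hEND N W γ W' hUτ hUtau hr hr' hsubτ lZ hlZ lD hlD 𝒦 h𝒦 Γ hlin χY₀ χcP hχ0 hχc0 Dfam Vk hAhol hGhol hVholb hχm
    hχcm hVm hAs qP h222 hqP h220U hw₂₀ hm

end Summit.QuantumFields.YangMills.BalabanUVNodes.N18EndLetters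

end
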